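import Literature.AnabelianGeometry.SemiGraphs.TemperedReconstructionAssembly
import Literature.AnabelianGeometry.SemiGraphs.TemperedMaximalCompactProofs
import Literature.AnabelianGeometry.SemiGraphs.TemperedEdgeLikeDistinctOf
import HarnessLib

/-!
# Semi-graphs of anabelioids, §3: Corollary 3.9 modulo Theorem 3.7 (i), (iii) and the steps R2, R3

Mochizuki, *Semi-graphs of anabelioids*, Publ. RIMS **42** (2006), §3, Corollary 3.9, manuscript
pp. 42–43 [cite: MochizukiSemiAnbd2006, Cor 3.9 pp.42-43].  Proof-only assembly: in
`corollary_3_9_of_residuals` the binders Thm. 3.7 (iv) `MaximalCompactIffVerticial` and the edge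
analogue `EdgeLikeDistinct` of Thm. 3.7 (ii) are now theorems of the tree modulo Thm. 3.7 (i), (iii)
(abc-iut-L3-t11: `maximalCompactIffVerticial_of_thm37`, `edgeLikeDistinct_of`; Thm. 3.7 (ii) is
`verticialDistinct_holds`, abc-iut-L3-t8).  HONEST RESIDUAL SET of Cor. 3.9 as typed after this file:
Thm. 3.7 (i) `VerticialInjective`, Thm. 3.7 (iii) `CompactInVerticial`, R2 `QuasiGeometricGraphData`
(whose vertex map, edge map and their compatibility are determined:
`existsUnique_vertexMap_of_isQuasiGeometric`, `existsUnique_edgeMap_of_isQuasiGeometric`,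
`edgeMap_abuts_vertexMap_of_isQuasiGeometric`), R3 `InducesOfCompatible`.
Nothing here takes a side on [IUTchIII] Cor. 3.12; typed ≠ discharged.
-/

namespace Literature.AnabelianGeometry.SemiGraphs

namespace ProfiniteSemiGraph

universe u

/-- **[SemiAnbd] Cor. 3.9 from Thm. 3.7 (i), (iii), the graph-data step R2 and the temperoid-level
step R3.** [cite: MochizukiSemiAnbd2006, Cor 3.9 pp.42-43] -/
theorem corollary_3_9_of_thm37_i_iii (h37i : VerticialInjective.{u}) (h37iii : CompactInVerticial.{u})
    (hR2 : QuasiGeometricGraphData.{u}) (hR3 : InducesOfCompatible.{u}) : Cor39.{u} :=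
  corollary_3_9_of_residuals h37i
    (maximalCompactIffVerticial_of_thm37 h37iii verticialDistinct_holds h37i)
    (edgeLikeDistinct_of h37iii verticialDistinct_holds h37i) hR2 hR3

end ProfiniteSemiGraph

end Literature.AnabelianGeometry.SemiGraphs
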